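import Literature.NumberTheory.EllipticCurves.LocalPointsModKernelOfReductionMultiplicativeProofs
import Literature.NumberTheory.EllipticCurves.TateCurve.MultiplicativeTwistUnramifiedProofs
import Literature.NumberTheory.EllipticCurves.KodairaNeronUnramifiedInertiaProofs
import Literature.NumberTheory.EllipticCurves.OrdinaryReductionTateModuleProofs
import Literature.NumberTheory.EllipticCurves.MultiplicativeInertiaLineProofs
import Literature.NumberTheory.EllipticCurves.TateCurve.InertiaTorsionOfTateParameterPower
import Literature.NumberTheory.EllipticCurves.FramedTateGaloisRep
import Literature.NumberTheory.GaloisRepresentations.OrdinaryGaloisRep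
import HarnessLib

/-!
# STUB-IDEAS `stub_liftFive` — ideator k = 3 (FAMILY 3, PROBE THE EXTREMES), GEN 10 companion

Crux `Summit.ABC.ABC.Theses.DefiniteXi.FreyModularity` (stmt-ABC-11340), skeleton `Lines/Sketch.lean`
(sha 21576c53), stub `stub_liftFive` (Diamond 1996 Thm 5.3 = `CDT_theorem_7_2_2 ∩ {25 ∤ N}`), consumed
ONCE, in case B of `isModular_freyCurve_of_stubs`, where the Frey curve is semistable and MULTIPLICATIVE
at `5` (gen-4 G1: `#Ẽ(𝔽₅) ≡ 0 (mod 12)` is impossible).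

GEN 10 = THE LOCAL SIDE OF THE MULTIPLICATIVE-ORDINARY CORNER, CLOSED.  Gens 6–9 reduced Wiles'
hypothesis (i) "`ρ_{E,5}` ordinary of weight `2` at `5`" for the pinned instance to a chain
L1/L7 (gen 9, proved) ⇒ P2 (gen 7, proved) ⇒ A3 (gen 8: frame lemma; gen 9: A3a/A3b proved, A3c
sorried) ⇒ P2′.  This file PROVES A3c and carries the WHOLE chain in one place, sorry-free, for every
number field `K`, every prime `p` and every multiplicative `v ∣ p`:

  `isOrdinaryOfWeightAt_framedTateGaloisRep_of_hasMultiplicativeReductionAt :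
     (p : 𝓞 K) ∈ v.asIdeal → W.HasMultiplicativeReductionAt v →
       FramedGaloisRep.IsOrdinaryOfWeightAt p (W.framedTateGaloisRep p) v 2 1`

= B. Conrad, CSS 1997 ch. XIV? (Cornell–Silverman–Stevens p. 446), **Thm. 1.1, multiplicative case**:
"`ρ_{E,p} ≃ (εχ ∗; 0 χ⁻¹)`, `χ` unramified … choosing consistent `pⁿ`-th roots of `1` in `ℚ̄_pˣ` gives
a rank-1 subrepresentation and the quotient is visibly unramified" — the μ-road of gen 9 is exactly
that sentence, typed.  In the Skinner–Wiles vocabulary of `OrdinaryGaloisRep.lean` (`θ₂ = 1`,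
`θ₁ = χ_p` ON INERTIA, exponent `m = 1`) the unramified twist `χ` (non-split case) is invisible, so
split and non-split multiplicative reduction are covered alike (gen-8 S0: the Tate twist is unramified).

TALLY (`lean check --no-snap`, rc 0): **0 sorries**.  PROVED here: M0–M4, M3b, L1, L7 (gen 9, verbatim);
L6, L2, L3, L5 and the P2 assembly `multiplicativeOrdinaryFiltration_of_L1_L7` (gen 7, verbatim);
A3a, A3b-i/ii/iii (gen 9), **A3c′ (frame form, NEW) and A3c (gen-8 signature VERBATIM, NEW)**;
the general theorem above and its `p = 5`, `K = ℚ` reading `ordinaryWeightTwoAtFive :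
OrdinaryWeightTwoAtFiveShape` (gen-6/8 shape verbatim — the hypothesis `hP2` of gen 6's PROVED
`liftFiveLocalCorner_of_wiles`).  With gen 7's PROVED P4 (`typeAOffFive`) every LOCAL hypothesis of
E6 `WilesOrdinaryLiftFive` on the pinned instance is now a theorem; the corner's only debt is E6
itself (Wiles 1995 Thm 0.2 (i) + Taylor–Wiles at `p = 5`, a named fact ≤ `CDT_theorem_7_2_2` by gen 6's
`wilesOrdinaryLiftFive_of_CDT_theorem_7_2_2`).

CROSS-SLOT: the `stub_liftThree` k3 line (`STUB_IDEAS_stub_liftThree_3g7/_3g9.lean`) types the same local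
condition as `HasOrdinaryLineAt W p v` (definitionally the body of P2's shape), proves it at `p = 3` over `ℚ`
by the Kato-filtration road, and leaves open its framed form L2f and the generic-`p` L2 — §5 below proves
both with `HasOrdinaryLineAt` unfolded (`exists_ordinaryLine_of_hasMultiplicativeReductionAt`,
`isOrdinaryOfWeightAt_framedTateGaloisRep_of_exists_ordinaryLine`), so ONE landing serves the ordinary
`R = T` cells at `3` (multiplicative-at-3 branch of `stub_liftThree`) and at `5` (case B of `stub_liftFive`).

Target files for provers (ONE Literature section file each, `--supports stmt-ABC-11340 --as helper`):
`Literature/NumberTheory/EllipticCurves/TateUniformisationPPowerTorsionProofs.lean` (§1–§2),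
`Literature/NumberTheory/EllipticCurves/MultiplicativeOrdinaryFiltrationProofs.lean` (§3),
`Literature/NumberTheory/EllipticCurves/MultiplicativeOrdinaryFrameProofs.lean` (§4–§5).
Literature-only imports; no new instances, no notation.
-/

noncomputable section

open scoped Classical NNReal NumberField AddSubgroup TensorProduct Pointwise
open NumberField IsDedekindDomain Field
open Literature.NumberTheory.EllipticCurves Literature.NumberTheory.EllipticCurves.TateCurve
open Literature.NumberTheory.GaloisRepresentations
open WeierstrassCurve IsDedekindDomain.HeightOneSpectrum

namespace Summit.ABC.ABC.Cruxes.FreyModularity.StubIdeas.LiftFive3g10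

/-! ## §0 The shapes (verbatim from gens 6–8) -/

/-- P2 shape (gen 6/7/8, verbatim). [cite: SilvermanATAEC1994, V §5 Thm. 5.3, Cor. 5.4; V §6 Prop. 6.1] -/
def MultiplicativeOrdinaryFiltrationShape : Prop :=
  ∀ {K : Type} [Field K] [NumberField K] (W : WeierstrassCurve K) [W.IsElliptic]
    (p : ℕ) [Fact p.Prime] (v : HeightOneSpectrum (𝓞 K)),
    (p : 𝓞 K) ∈ v.asIdeal → W.HasMultiplicativeReductionAt v →
    ∃ L : Submodule ℚ_[p] (W.rationalTateModule p),
      Module.finrank ℚ_[p] L = 1 ∧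
      (∀ (τ : absoluteGaloisGroup (v.adicCompletion K)), ∀ x ∈ L,
        W.rationalGaloisRepTate p (absGaloisRestrict K (v.adicCompletion K) τ) x ∈ L) ∧
      (∀ τ ∈ absInertia (v.adicCompletion K), ∀ x ∈ L,
        W.rationalGaloisRepTate p (absGaloisRestrict K (v.adicCompletion K) τ) x =
          (((GaloisRep.cyclotomicCharacter (v.adicCompletion K) p τ : ℤ_[p]ˣ) : ℤ_[p]) : ℚ_[p]) • x) ∧
      (∀ τ ∈ absInertia (v.adicCompletion K), ∀ x : W.rationalTateModule p,
        W.rationalGaloisRepTate p (absGaloisRestrict K (v.adicCompletion K) τ) x - x ∈ L)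

/-- P2′ shape (gen 6/8 verbatim, the hypothesis `hP2` of gen 6's `liftFiveLocalCorner_of_wiles`); the
`Fact (Nat.Prime 5)` instance gens 6–8 declared is inlined by `haveI` (no instance is declared in this
file; `Fact` is a `Prop`, so the term is the gen-8 one up to proof irrelevance).
[cite: SkinnerWiles1999, §1 Theorem (ii)] [cite: SilvermanATAEC1994, V §5 Thm. 5.3] -/
def OrdinaryWeightTwoAtFiveShape : Prop :=
  haveI : Fact (Nat.Prime 5) := ⟨Nat.prime_five⟩
  ∀ (W : WeierstrassCurve ℚ) [W.IsElliptic] (v : HeightOneSpectrum (𝓞 ℚ)),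
    ((5 : ℕ) : 𝓞 ℚ) ∈ v.asIdeal → W.HasMultiplicativeReductionAt v →
    FramedGaloisRep.IsOrdinaryOfWeightAt 5 (W.framedTateGaloisRep 5) v 2 1

/-! ## §1 The μ-road: `E₁(K̄_v)[pⁿ] = Ψ(μ_{pⁿ})` for Tate data `(q, Ψ)` at a multiplicative `v ∣ p` -/

section MuRoad

variable {K : Type} [Field K] [NumberField K] (W : WeierstrassCurve K) [W.IsElliptic]
  (v : HeightOneSpectrum (𝓞 K)) {p : ℕ} [hp : Fact p.Prime]

/-- **M0 (XS) — PROVED.** `|q^m| = 1` in `K̄_v` forces `m = 0` when `0 < |q| < 1` (valuation form of the tree's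
`TateCurve.zpow_algebraMap_eq_one_iff`; bridge `coe_spectralValuation_algebraMap` /
`spectralValuation_algebraMap_lt_one_of_mem_maximalIdeal`). [cite: SilvermanATAEC1994, Thm. V.3.1 (d) (proof, PDF p. 399)] -/
theorem eq_zero_of_spectralValuation_zpow_eq_one {q : v.adicCompletion K} (hq0 : q ≠ 0)
    (hq1 : Valued.v q < 1) {m : ℤ}
    (hm : v.spectralValuation
      (algebraMap (v.adicCompletion K) (AlgebraicClosure (v.adicCompletion K)) q ^ m) = 1) :
    m = 0 := by
  set x := v.spectralValuation
    (algebraMap (v.adicCompletion K) (AlgebraicClosure (v.adicCompletion K)) q) with hxdef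
  have hx0 : 0 < x := by
    rw [hxdef, Valuation.pos_iff]
    exact (map_ne_zero (algebraMap _ _)).mpr hq0
  have hx1 : x < 1 := by
    rw [hxdef, ← NNReal.coe_lt_coe, coe_spectralValuation_algebraMap v.coe_spectralValuation,
      NNReal.coe_one, Valued.toNormedField.norm_lt_one_iff]
    exact hq1
  rw [map_zpow₀] at hm
  exact (zpow_eq_one_iff_right₀ hx0.le hx1.ne).mp hm

omit [W.IsElliptic] in
/-- **M1 (XS, tree-verbatim) — PROVED.** `Ψ` is injective on `μ_l(K̄_v)`: `Ψ(u) = Ψ(u')`, `u^l = u'^l = 1` ⇒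
`u/u' ∈ q^ℤ ∩ μ_l = 1`.  Verbatim the `hinj` block of `TateCurve.exists_subgroup_coe_eq_image_rootsOfUnity`
(there over a normed field; here `|·| = v.spectralValuation`, M0). [cite: MochizukiGenEll2010, §3 Lem 3.2 p.15]
[cite: SilvermanATAEC1994, Thm. V.3.1 (c),(d)] -/
theorem injOn_tate_pow_eq_one {q : v.adicCompletion K} (hq0 : q ≠ 0) (hq1 : Valued.v q < 1)
    (Ψ : Additive (AlgebraicClosure (v.adicCompletion K))ˣ →+ localPoints W (v.adicCompletion K))
    (hker : ∀ u : (AlgebraicClosure (v.adicCompletion K))ˣ, Ψ (Additive.ofMul u) = 0 ↔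
      ∃ n : ℤ, (u : AlgebraicClosure (v.adicCompletion K)) =
        algebraMap (v.adicCompletion K) (AlgebraicClosure (v.adicCompletion K)) q ^ n)
    {l : ℕ} (hl : 0 < l) :
    Set.InjOn (fun u : (AlgebraicClosure (v.adicCompletion K))ˣ ↦ Ψ (Additive.ofMul u))
      {u | u ^ l = 1} := by
  -- verbatim the `hinj` block of `TateCurve.exists_subgroup_coe_eq_image_rootsOfUnity`
  have hq : ‖q‖ < 1 := Valued.toNormedField.norm_lt_one_iff.mpr hq1
  set qb : AlgebraicClosure (v.adicCompletion K) :=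
    algebraMap (v.adicCompletion K) (AlgebraicClosure (v.adicCompletion K)) q with hqb_def
  intro u hu u' hu' huu'
  have hu1 : u ^ l = 1 := hu
  have hu1' : u' ^ l = 1 := hu'
  have huv' : Ψ (Additive.ofMul u) = Ψ (Additive.ofMul u') := huu'
  have h0 : Ψ (Additive.ofMul (u * u'⁻¹)) = 0 := by
    rw [ofMul_mul, ofMul_inv, map_add, map_neg, huv', add_neg_cancel]
  obtain ⟨n, hn⟩ := (hker _).mp h0
  have hnl : (fun k : ℤ ↦ algebraMap (v.adicCompletion K) (AlgebraicClosure (v.adicCompletion K)) q ^ k)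
      (n * l) =
      (fun k : ℤ ↦ algebraMap (v.adicCompletion K) (AlgebraicClosure (v.adicCompletion K)) q ^ k) 0 := by
    show qb ^ (n * l) = qb ^ (0 : ℤ)
    rw [zpow_zero, zpow_mul, zpow_natCast, ← hn, ← Units.val_pow_eq_pow_val, mul_pow, hu1, inv_pow,
      hu1', inv_one, mul_one, Units.val_one]
  have hnl' : n * l = 0 := TateCurve.zpow_algebraMap_injective hq0 hq hnl
  have hn0 : n = 0 := by
    rcases mul_eq_zero.mp hnl' with h | h
    · exact h
    · exact absurd (by exact_mod_cast h : l = 0) hl.ne'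
  rw [hn0, zpow_zero] at hn
  exact mul_inv_eq_one.mp (Units.ext hn)

omit [W.IsElliptic] in
/-- **M2 (XS, tree-verbatim) — PROVED.** `#Ψ(μ_l(K̄_v)) = l`: M1 + `Set.InjOn.ncard_image` +
`HasEnoughRootsOfUnity.natCard_rootsOfUnity` (`K̄_v` algebraically closed of characteristic `0`) —
verbatim the cardinality block of `TateCurve.exists_subgroup_coe_eq_image_rootsOfUnity`.
[cite: MochizukiGenEll2010, §3 Lem 3.2 p.15] -/
theorem ncard_image_tate_pow_eq_one {q : v.adicCompletion K} (hq0 : q ≠ 0) (hq1 : Valued.v q < 1)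
    (Ψ : Additive (AlgebraicClosure (v.adicCompletion K))ˣ →+ localPoints W (v.adicCompletion K))
    (hker : ∀ u : (AlgebraicClosure (v.adicCompletion K))ˣ, Ψ (Additive.ofMul u) = 0 ↔
      ∃ n : ℤ, (u : AlgebraicClosure (v.adicCompletion K)) =
        algebraMap (v.adicCompletion K) (AlgebraicClosure (v.adicCompletion K)) q ^ n)
    {l : ℕ} (hl : 0 < l) :
    ((fun u : (AlgebraicClosure (v.adicCompletion K))ˣ ↦ Ψ (Additive.ofMul u)) '' {u | u ^ l = 1}).ncard
      = l := by
  -- verbatim the cardinality block of `TateCurve.exists_subgroup_coe_eq_image_rootsOfUnity`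
  haveI : NeZero l := ⟨hl.ne'⟩
  haveI : CharZero (v.adicCompletion K) :=
    charZero_of_injective_algebraMap (algebraMap K (v.adicCompletion K)).injective
  haveI : CharZero (AlgebraicClosure (v.adicCompletion K)) := charZero_of_injective_algebraMap
    (algebraMap (v.adicCompletion K) (AlgebraicClosure (v.adicCompletion K))).injective
  haveI : NeZero (l : v.adicCompletion K) := ⟨Nat.cast_ne_zero.mpr hl.ne'⟩
  haveI : NeZero (l : AlgebraicClosure (v.adicCompletion K)) := ⟨Nat.cast_ne_zero.mpr hl.ne'⟩
  have hE : ({u : (AlgebraicClosure (v.adicCompletion K))ˣ | u ^ l = 1} : Set _) =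
      (rootsOfUnity l (AlgebraicClosure (v.adicCompletion K)) : Set _) := by
    ext u
    simp [mem_rootsOfUnity]
  rw [(injOn_tate_pow_eq_one W v hq0 hq1 Ψ hker hl).ncard_image, hE, ← Nat.card_coe_set_eq]
  exact HasEnoughRootsOfUnity.natCard_rootsOfUnity (AlgebraicClosure (v.adicCompletion K)) l

omit [W.IsElliptic] in
/-- **M3 (S) — the extremal description of `E₁[pⁿ]` — PROVED.** For Tate data `(q, Ψ)` with `ker Ψ = q^ℤ` and
`E₁ = Ψ(1 + 𝔪)` at a place `v ∣ p`: `P ∈ E₁(K̄_v)` with `pⁿ P = O` iff `P = Ψ(u)` with `u^{pⁿ} = 1`.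
(→) `P = Ψ(u)`, `u` a principal unit; `Ψ(u^{pⁿ}) = pⁿP = O` gives `u^{pⁿ} = q^m`, and `|u| = 1` gives
`|q^m| = 1`, so `m = 0` (M0).  (←) `|u|^{pⁿ} = 1 ⇒ |u| = 1`, and `u^{pⁿ} - 1 = 0` is "principal", so
`u` is a principal unit (`WeierstrassCurve.spectralValuation_sub_one_lt_one_of_pow`), i.e. `Ψ(u) ∈ E₁`;
`pⁿ Ψ(u) = Ψ(u^{pⁿ}) = Ψ(1) = O`.  [cite: SilvermanATAEC1994, §V.4 (PDF pp. 399–401), Thm. V.5.3]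
[cite: SerreLocalFields1979, Ch. IV §4 Prop. 17] -/
theorem mem_localKernelOfReduction_and_nsmul_eq_zero_iff_of_tate
    (hpv : ((p : ℕ) : 𝓞 K) ∈ v.asIdeal) {q : v.adicCompletion K} (hq0 : q ≠ 0) (hq1 : Valued.v q < 1)
    (Ψ : Additive (AlgebraicClosure (v.adicCompletion K))ˣ →+ localPoints W (v.adicCompletion K))
    (hker : ∀ u : (AlgebraicClosure (v.adicCompletion K))ˣ, Ψ (Additive.ofMul u) = 0 ↔
      ∃ n : ℤ, (u : AlgebraicClosure (v.adicCompletion K)) =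
        algebraMap (v.adicCompletion K) (AlgebraicClosure (v.adicCompletion K)) q ^ n)
    (hiff : ∀ P : localPoints W (v.adicCompletion K), P ∈ W.localKernelOfReduction v ↔
      ∃ u : (AlgebraicClosure (v.adicCompletion K))ˣ,
        v.spectralValuation ((u : AlgebraicClosure (v.adicCompletion K)) - 1) < 1 ∧
          Ψ (Additive.ofMul u) = P)
    (n : ℕ) (P : localPoints W (v.adicCompletion K)) :
    (P ∈ W.localKernelOfReduction v ∧ p ^ n • P = 0) ↔
      ∃ u : (AlgebraicClosure (v.adicCompletion K))ˣ, u ^ p ^ n = 1 ∧ Ψ (Additive.ofMul u) = P := by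
  -- a principal unit is a unit
  have unit_of_principal : ∀ {x : AlgebraicClosure (v.adicCompletion K)},
      v.spectralValuation (x - 1) < 1 → v.spectralValuation x = 1 := by
    intro x hx
    have h := Valuation.map_add_eq_of_lt_left v.spectralValuation
      (x := (1 : AlgebraicClosure (v.adicCompletion K))) (y := x - 1) (by rw [map_one]; exact hx)
    rwa [map_one, add_sub_cancel] at h
  constructor
  · rintro ⟨hP, hpn⟩
    obtain ⟨u, hu1, huP⟩ := (hiff P).mp hP
    -- `Ψ(u^{pⁿ}) = pⁿ P = 0`, so `u^{pⁿ} = q^m`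
    have h0 : Ψ (Additive.ofMul (u ^ p ^ n)) = 0 := by
      rw [ofMul_pow, map_nsmul, huP, hpn]
    obtain ⟨m, hm⟩ := (hker _).mp h0
    -- `|u| = 1` forces `|q^m| = 1`, hence `m = 0` (M0)
    have hu_one : v.spectralValuation (u : AlgebraicClosure (v.adicCompletion K)) = 1 :=
      unit_of_principal hu1
    have hqm : v.spectralValuation
        (algebraMap (v.adicCompletion K) (AlgebraicClosure (v.adicCompletion K)) q ^ m) = 1 := by
      rw [← hm, Units.val_pow_eq_pow_val, map_pow, hu_one, one_pow]
    have hm0 : m = 0 := eq_zero_of_spectralValuation_zpow_eq_one v hq0 hq1 hqm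
    refine ⟨u, Units.ext ?_, huP⟩
    rw [hm, hm0, zpow_zero, Units.val_one]
  · rintro ⟨u, hupn, rfl⟩
    -- `|u|^{pⁿ} = 1 ⇒ |u| = 1`, and `u^{pⁿ} = 1` is principal, so `u` is a principal unit (`v ∣ p`)
    have hu_one : v.spectralValuation (u : AlgebraicClosure (v.adicCompletion K)) = 1 := by
      have h : v.spectralValuation (u : AlgebraicClosure (v.adicCompletion K)) ^ p ^ n = 1 := by
        rw [← map_pow, ← Units.val_pow_eq_pow_val, hupn, Units.val_one, map_one]
      exact (pow_eq_one_iff_of_nonneg zero_le (pow_ne_zero n hp.out.ne_zero)).mp h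
    have hprin : v.spectralValuation ((u : AlgebraicClosure (v.adicCompletion K)) - 1) < 1 := by
      refine spectralValuation_sub_one_lt_one_of_pow hpv n hu_one ?_
      rw [← Units.val_pow_eq_pow_val, hupn, Units.val_one, sub_self, map_zero]
      exact one_pos
    refine ⟨(hiff _).mpr ⟨u, hprin, rfl⟩, ?_⟩
    rw [← map_nsmul, ← ofMul_pow, hupn, ofMul_one, map_zero]

omit [W.IsElliptic] hp in
/-- **M3b (XS, bookkeeping) — PROVED.** The `pⁿ`-torsion of the subgroup `E₁(K̄_v)` counted inside
`E(K̄_v)`. [folklore] -/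
theorem natCard_torsionBy_localKernelOfReduction_eq_ncard (n : ℕ) :
    Nat.card ((W.localKernelOfReduction v)[(p ^ n : ℕ)]) =
      ({P : localPoints W (v.adicCompletion K) |
        P ∈ W.localKernelOfReduction v ∧ p ^ n • P = 0}).ncard := by
  classical
  rw [← Nat.card_coe_set_eq]
  refine Nat.card_congr ?_
  refine
    { toFun := fun x =>
        ⟨((x : W.localKernelOfReduction v) : localPoints W (v.adicCompletion K)),
          (x : W.localKernelOfReduction v).2, ?_⟩
      invFun := fun P => ⟨⟨P.1, P.2.1⟩, ?_⟩
      left_inv := fun x => rfl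
      right_inv := fun P => rfl }
  · have h := AddSubgroup.torsionBy.nsmul_iff.mp x.2
    have h' := congrArg Subtype.val h
    rwa [AddSubmonoidClass.coe_nsmul, ZeroMemClass.coe_zero] at h'
  · apply AddSubgroup.torsionBy.nsmul_iff.mpr
    apply Subtype.ext
    simpa using P.2.2

omit [W.IsElliptic] in
/-- **M4 (XS) — the core of L7 — PROVED (from M3 ←).** If `Ψ` is `τ`-equivariant and `u^{pⁿ} ∈ q^ℤ`, then
`τ • Ψ(u) - Ψ(u) = Ψ(τu/u) ∈ E₁(K̄_v)`: `(τu/u)^{pⁿ} = τ(q^m)/q^m = 1` (`q^m ∈ K_v` is fixed by `τ`,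
`AlgEquiv.commutes`), then M3 (←). [cite: SilvermanATAEC1994, Lemma V.5.2 (c), Thm. V.5.3 (PDF pp. 407–410)] -/
theorem smul_sub_mem_localKernelOfReduction_of_tate_equivariant
    (hpv : ((p : ℕ) : 𝓞 K) ∈ v.asIdeal) {q : v.adicCompletion K} (hq0 : q ≠ 0) (hq1 : Valued.v q < 1)
    (Ψ : Additive (AlgebraicClosure (v.adicCompletion K))ˣ →+ localPoints W (v.adicCompletion K))
    (hker : ∀ u : (AlgebraicClosure (v.adicCompletion K))ˣ, Ψ (Additive.ofMul u) = 0 ↔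
      ∃ n : ℤ, (u : AlgebraicClosure (v.adicCompletion K)) =
        algebraMap (v.adicCompletion K) (AlgebraicClosure (v.adicCompletion K)) q ^ n)
    (hiff : ∀ P : localPoints W (v.adicCompletion K), P ∈ W.localKernelOfReduction v ↔
      ∃ u : (AlgebraicClosure (v.adicCompletion K))ˣ,
        v.spectralValuation ((u : AlgebraicClosure (v.adicCompletion K)) - 1) < 1 ∧
          Ψ (Additive.ofMul u) = P)
    {τ : absoluteGaloisGroup (v.adicCompletion K)}
    (hτΨ : ∀ u : (AlgebraicClosure (v.adicCompletion K))ˣ,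
      τ • Ψ (Additive.ofMul u) =
        Ψ (Additive.ofMul (Units.map
          (absoluteGaloisGroup.toAlgEquiv (v.adicCompletion K) τ :
            AlgebraicClosure (v.adicCompletion K) →* AlgebraicClosure (v.adicCompletion K)) u)))
    {n : ℕ} {u : (AlgebraicClosure (v.adicCompletion K))ˣ}
    (hu : ∃ m : ℤ, ((u ^ p ^ n : (AlgebraicClosure (v.adicCompletion K))ˣ) :
        AlgebraicClosure (v.adicCompletion K)) =
      algebraMap (v.adicCompletion K) (AlgebraicClosure (v.adicCompletion K)) q ^ m) :
    τ • Ψ (Additive.ofMul u) - Ψ (Additive.ofMul u) ∈ W.localKernelOfReduction v := by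
  obtain ⟨m, hm⟩ := hu
  set σ := absoluteGaloisGroup.toAlgEquiv (v.adicCompletion K) τ with hσ
  set u' : (AlgebraicClosure (v.adicCompletion K))ˣ :=
    Units.map (σ : AlgebraicClosure (v.adicCompletion K) →* AlgebraicClosure (v.adicCompletion K)) u
    with hu'
  have hrew : τ • Ψ (Additive.ofMul u) - Ψ (Additive.ofMul u) =
      Ψ (Additive.ofMul (u' * u⁻¹)) := by
    rw [hτΨ u, ofMul_mul, ofMul_inv, map_add, map_neg, sub_eq_add_neg]
  -- `(τu/u)^{pⁿ} = τ(q^m)/q^m = 1`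
  have hpow : (u' * u⁻¹) ^ p ^ n = 1 := by
    rw [mul_pow, inv_pow, mul_inv_eq_one]
    refine Units.ext ?_
    rw [hu', ← map_pow, Units.coe_map, MonoidHom.coe_coe, hm, map_zpow₀, AlgEquiv.commutes]
  have key := (mem_localKernelOfReduction_and_nsmul_eq_zero_iff_of_tate W v hpv hq0 hq1 Ψ hker hiff n
    (Ψ (Additive.ofMul (u' * u⁻¹)))).mpr ⟨u' * u⁻¹, hpow, rfl⟩
  rw [hrew]
  exact key.1

/-- **L1 (gen-7 signature VERBATIM) — PROVED (M2 + M3 + M3b; sorry-free).** `#E₁(K̄_v)[pⁿ] = pⁿ`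
at a multiplicative `v ∣ p`. [cite: SilvermanATAEC1994, §V.4 (PDF pp. 399–401), Thm. V.5.3] -/
theorem natCard_torsionBy_localKernelOfReduction_eq (hpv : ((p : ℕ) : 𝓞 K) ∈ v.asIdeal)
    (hmult : W.HasMultiplicativeReductionAt v) (n : ℕ) :
    Nat.card ((W.localKernelOfReduction v)[(p ^ n : ℕ)]) = p ^ n := by
  obtain ⟨q, t, Ψ, hq0, hq1, -, -, -, hker, -, hiff⟩ :=
    exists_twistedTateUniformisation_localKernelOfReduction_iff W v hmult
  rw [natCard_torsionBy_localKernelOfReduction_eq_ncard W v n]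
  have hset : ({P : localPoints W (v.adicCompletion K) |
        P ∈ W.localKernelOfReduction v ∧ p ^ n • P = 0}) =
      (fun u : (AlgebraicClosure (v.adicCompletion K))ˣ ↦ Ψ (Additive.ofMul u)) ''
        {u | u ^ p ^ n = 1} := by
    ext P
    rw [Set.mem_setOf_eq, Set.mem_image,
      mem_localKernelOfReduction_and_nsmul_eq_zero_iff_of_tate W v hpv hq0 hq1 Ψ hker hiff n P]
    simp only [Set.mem_setOf_eq]
  rw [hset]
  exact ncard_image_tate_pow_eq_one W v hq0 hq1 Ψ hker (pow_pos hp.out.pos n)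

/-- **L7 (gen-7 statement VERBATIM, RENAMED** — the tree already has
`smul_sub_mem_localKernelOfReduction_of_mem_absInertia` for GOOD reduction in
`LocalPointsOrdinaryKummerCongruenceProofs`) — **PROVED from M4 + gen-8 S0 (inlined); sorry-free.**
At a multiplicative `v ∣ p` the inertia group acts trivially on `E(K̄_v)[p^∞]` modulo `E₁(K̄_v)`.
[cite: SilvermanATAEC1994, Lemma V.5.2 (c), Thm. V.5.3 (PDF pp. 407–410)] -/
theorem smul_sub_mem_localKernelOfReduction_of_mem_absInertia_of_hasMultiplicativeReductionAt
    (hpv : ((p : ℕ) : 𝓞 K) ∈ v.asIdeal) (hmult : W.HasMultiplicativeReductionAt v)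
    {τ : absoluteGaloisGroup (v.adicCompletion K)} (hτ : τ ∈ absInertia (v.adicCompletion K))
    {n : ℕ} {Q : localPoints W (v.adicCompletion K)} (hQ : p ^ n • Q = 0) :
    τ • Q - Q ∈ W.localKernelOfReduction v := by
  obtain ⟨q, t, Ψ, hq0, hq1, -, ht, hsurj, hker, hΨσ, hiff⟩ :=
    exists_twistedTateUniformisation_localKernelOfReduction_iff W v hmult
  obtain ⟨w, hw⟩ := v.exists_spectralValuation
  obtain ⟨𝔐, h𝔐⟩ := v.localPrimesAbove_nonempty
  have hτ' : τ ∈ 𝔐.inertia (absoluteGaloisGroup (v.adicCompletion K)) := by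
    rw [inertia_eq_absInertia hw h𝔐]; exact hτ
  have hτt : absoluteGaloisGroup.toAlgEquiv (v.adicCompletion K) τ t = t :=
    toAlgEquiv_eq_of_mem_inertia_of_sq_eq_gamma W hmult h𝔐 ht hτ'
  have hτΨ : ∀ u : (AlgebraicClosure (v.adicCompletion K))ˣ,
      τ • Ψ (Additive.ofMul u) =
        Ψ (Additive.ofMul (Units.map
          (absoluteGaloisGroup.toAlgEquiv (v.adicCompletion K) τ :
            AlgebraicClosure (v.adicCompletion K) →* AlgebraicClosure (v.adicCompletion K)) u)) := by
    intro u
    rw [hΨσ τ u, if_pos hτt, one_zsmul]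
  obtain ⟨x, rfl⟩ := hsurj Q
  have h0 : Ψ (Additive.ofMul ((Additive.toMul x) ^ p ^ n)) = 0 := by
    rw [ofMul_pow, ofMul_toMul, map_nsmul, hQ]
  obtain ⟨m, hm⟩ := (hker _).mp h0
  have key := smul_sub_mem_localKernelOfReduction_of_tate_equivariant W v hpv hq0 hq1 Ψ hker hiff
    hτΨ (n := n) (u := Additive.toMul x) ⟨m, hm⟩
  simpa only [ofMul_toMul] using key

end MuRoad

/-! ## §2 The gen-7 currency: L1/L7 as named facts ⇒ P2 (gen 7's PROVED `multiplicativeOrdinaryFiltration_of_L1_L7`) -/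

/-- gen-7 `L1Statement` (verbatim). -/
def L1Statement : Prop :=
  ∀ {K : Type} [Field K] [NumberField K] (W : WeierstrassCurve K) [W.IsElliptic]
    (p : ℕ) [Fact p.Prime] (v : HeightOneSpectrum (𝓞 K)),
    ((p : ℕ) : 𝓞 K) ∈ v.asIdeal → W.HasMultiplicativeReductionAt v →
    ∀ n : ℕ, Nat.card ((W.localKernelOfReduction v)[(p ^ n : ℕ)]) = p ^ n

/-- gen-7 `L7Statement` (verbatim). -/
def L7Statement : Prop :=
  ∀ {K : Type} [Field K] [NumberField K] (W : WeierstrassCurve K) [W.IsElliptic]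
    (p : ℕ) [Fact p.Prime] (v : HeightOneSpectrum (𝓞 K)),
    ((p : ℕ) : 𝓞 K) ∈ v.asIdeal → W.HasMultiplicativeReductionAt v →
    ∀ τ ∈ absInertia (v.adicCompletion K), ∀ (n : ℕ) (Q : localPoints W (v.adicCompletion K)),
      p ^ n • Q = 0 → τ • Q - Q ∈ W.localKernelOfReduction v

/-- **L1 holds** — sorry-free. [folklore] -/
theorem l1Statement_holds : L1Statement := by
  intro K _ _ W _ p _ v hpv hmult n
  exact natCard_torsionBy_localKernelOfReduction_eq W v hpv hmult n

/-- **L7 holds** — sorry-free. [folklore] -/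
theorem l7Statement_holds : L7Statement := by
  intro K _ _ W _ p _ v hpv hmult τ hτ n Q hQ
  exact smul_sub_mem_localKernelOfReduction_of_mem_absInertia_of_hasMultiplicativeReductionAt W v hpv
    hmult hτ hQ

/-! ## §3 P2 assembled from L1 and L7 (gen 7, verbatim: Step 7 of the good-ordinary proof with `Ẽ(k̄)` replaced by `E(K̄_v)/E₁`) -/

/-! ### §3a L6 — torsion-level kernel lemma (general additive groups; proved, gen 7) -/

section L6

variable {A : Type} [AddCommGroup A] {B : Type} [AddCommGroup B] {p : ℕ} [Fact p.Prime]
  (f : A →+ B) {G : Type*} [Monoid G] [DistribMulAction G A]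

/-- `T_p f (τ • y) = T_p f y` as soon as `f (τ • x) = f x` on every `A[pⁿ]` (only the `p`-power
torsion of `A` is seen by `T_p`). [folklore] -/
theorem tateModule_map_smul_of_invariant_on_torsionBy (τ : G)
    (hf : ∀ n : ℕ, ∀ x ∈ A[(p ^ n : ℕ)], f (τ • x) = f x) (y : TateModule A p) :
    TateModule.map p f (τ • y) = TateModule.map p f y :=
  TateModule.ext fun n ↦ by
    rw [TateModule.proj_map, TateModule.proj_smul_of_distribMulAction, TateModule.proj_map]
    exact hf n _ (TateModule.proj_mem_torsionBy n y)

/-- **L6.** `τ • x - x ∈ ker V_p f` when `f (τ • a) = f a` for all `a ∈ A[pⁿ]`, all `n` — the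
torsion-level variant of `RationalTateModule.baseChange_tateRepresentation_sub_mem_ker` (whose hypothesis
`∀ a, f (τ • a) = f a` FAILS for `f = (E(K̄_v) → E(K̄_v)/E₁)`, tame inertia moving `Ψ(π^{1/n})`).
[cite: Greenberg1991, §2 (p. 214)] -/
theorem baseChange_tateRepresentation_sub_mem_ker_of_torsionBy (τ : G)
    (hf : ∀ n : ℕ, ∀ x ∈ A[(p ^ n : ℕ)], f (τ • x) = f x) (x : ℚ_[p] ⊗[ℤ_[p]] TateModule A p) :
    (tateRepresentation G A p τ).baseChange ℚ_[p] x - x ∈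
      LinearMap.ker ((TateModule.map p f).baseChange ℚ_[p]) := by
  rw [LinearMap.mem_ker, map_sub, sub_eq_zero]
  induction x using TensorProduct.induction_on with
  | zero => simp only [map_zero]
  | tmul c y =>
    rw [LinearMap.baseChange_tmul, LinearMap.baseChange_tmul, LinearMap.baseChange_tmul,
      tateRepresentation_apply_apply, tateModule_map_smul_of_invariant_on_torsionBy f τ hf]
  | add x y hx hy => simp only [map_add, hx, hy]

end L6

/-! ### §3b The local helper lemmas L2/L3/L5 at a multiplicative `v ∣ p` (proved, gen 7) -/

section Local

variable {K : Type} [Field K] [NumberField K] (W : WeierstrassCurve K) [W.IsElliptic]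
  {p : ℕ} [hp : Fact p.Prime] {v : HeightOneSpectrum (𝓞 K)}

/-- **L2 (proved).** A class of `E(K̄_v)/E₁` killed by `pⁿ` has a `pⁿ`-torsion representative — from
(div₁) `exists_nsmul_pow_eq_of_mem_localKernelOfReduction_of_hasMultiplicativeReductionAt`. [folklore] -/
theorem exists_torsion_sub_mem_localKernelOfReduction (hpv : ((p : ℕ) : 𝓞 K) ∈ v.asIdeal)
    (hmult : W.HasMultiplicativeReductionAt v) (n : ℕ) {Q : localPoints W (v.adicCompletion K)}
    (hQ : p ^ n • Q ∈ W.localKernelOfReduction v) :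
    ∃ Q' : localPoints W (v.adicCompletion K),
      p ^ n • Q' = 0 ∧ Q' - Q ∈ W.localKernelOfReduction v := by
  obtain ⟨Z, hZ, hZQ⟩ :=
    W.exists_nsmul_pow_eq_of_mem_localKernelOfReduction_of_hasMultiplicativeReductionAt hpv hmult n hQ
  refine ⟨Q - Z, ?_, ?_⟩
  · rw [smul_sub, hZQ, sub_self]
  · rw [sub_sub_cancel_left]
    exact neg_mem hZ

/-- **L3 (proved from L1 + L2).** `#(E(K̄_v)/E₁)[pⁿ] = pⁿ`: `#E₁[pⁿ] · #(E/E₁)[pⁿ] = #E[pⁿ] = p²ⁿ`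
(`TateModule.card_ker_torsionBy_mul_card`, surjectivity on torsion = L2). [folklore] -/
theorem natCard_torsionBy_quotient_localKernelOfReduction_eq (hpv : ((p : ℕ) : 𝓞 K) ∈ v.asIdeal)
    (hmult : W.HasMultiplicativeReductionAt v)
    (hL1 : ∀ n : ℕ, Nat.card ((W.localKernelOfReduction v)[(p ^ n : ℕ)]) = p ^ n) (n : ℕ) :
    Nat.card ((localPoints W (v.adicCompletion K) ⧸ W.localKernelOfReduction v)[(p ^ n : ℕ)]) =
      p ^ n := by
  haveI : CharZero (AlgebraicClosure (v.adicCompletion K)) :=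
    charZero_of_injective_algebraMap (algebraMap K (AlgebraicClosure (v.adicCompletion K))).injective
  have hp0 : p ^ n ≠ 0 := pow_ne_zero n hp.out.ne_zero
  have hcardL : Nat.card ((localPoints W (v.adicCompletion K))[(p ^ n : ℕ)]) = p ^ n * p ^ n := by
    have h := card_torsionBy_eq_sq (E := W.baseChange (AlgebraicClosure (v.adicCompletion K)))
      (n := p ^ n) (by exact_mod_cast hp0)
    rw [sq] at h
    exact h
  have hsurj : ∀ y ∈ (localPoints W (v.adicCompletion K) ⧸ W.localKernelOfReduction v)[(p ^ n : ℕ)],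
      ∃ x ∈ (localPoints W (v.adicCompletion K))[(p ^ n : ℕ)],
        QuotientAddGroup.mk' (W.localKernelOfReduction v) x = y := by
    intro y hy
    obtain ⟨Q, rfl⟩ := QuotientAddGroup.mk'_surjective (W.localKernelOfReduction v) y
    have hQ : p ^ n • Q ∈ W.localKernelOfReduction v := by
      rw [← QuotientAddGroup.eq_zero_iff, QuotientAddGroup.mk_nsmul]
      have h := AddSubgroup.torsionBy.nsmul_iff.mp hy
      rwa [QuotientAddGroup.mk'_apply] at h
    obtain ⟨Q', hQ', hQ'Q⟩ := exists_torsion_sub_mem_localKernelOfReduction W hpv hmult n hQ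
    refine ⟨Q', AddSubgroup.torsionBy.nsmul_iff.mpr hQ', ?_⟩
    rw [QuotientAddGroup.mk'_apply, QuotientAddGroup.mk'_apply, QuotientAddGroup.eq_iff_sub_mem]
    exact hQ'Q
  have hmul := TateModule.card_ker_torsionBy_mul_card
    (QuotientAddGroup.mk' (W.localKernelOfReduction v)) (p ^ n) hsurj
  rw [QuotientAddGroup.ker_mk', hL1 n, hcardL] at hmul
  exact Nat.eq_of_mul_eq_mul_left (Nat.pos_of_ne_zero hp0) hmul

/-- **L5 (proved from L2 + counting).** `f = (E(K̄) → E(K̄_v) → E(K̄_v)/E₁)` maps `E[pⁿ]` ONTO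
`(E(K̄_v)/E₁)[pⁿ]` (all torsion of `E(K̄_v)` is algebraic: `exists_mem_torsionBy_eq_of_injective`). [folklore] -/
theorem exists_torsionBy_comp_pointsMap_eq (hpv : ((p : ℕ) : 𝓞 K) ∈ v.asIdeal)
    (hmult : W.HasMultiplicativeReductionAt v) (n : ℕ)
    (y : localPoints W (v.adicCompletion K) ⧸ W.localKernelOfReduction v)
    (hy : y ∈ (localPoints W (v.adicCompletion K) ⧸ W.localKernelOfReduction v)[(p ^ n : ℕ)]) :
    ∃ x ∈ (geomPoints W)[(p ^ n : ℕ)],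
      (QuotientAddGroup.mk' (W.localKernelOfReduction v)).comp (pointsMap W (v.adicCompletion K)) x =
        y := by
  haveI : CharZero (AlgebraicClosure (v.adicCompletion K)) :=
    charZero_of_injective_algebraMap (algebraMap K (AlgebraicClosure (v.adicCompletion K))).injective
  haveI : CharZero (AlgebraicClosure K) :=
    charZero_of_injective_algebraMap (algebraMap K (AlgebraicClosure K)).injective
  have hp0 : p ^ n ≠ 0 := pow_ne_zero n hp.out.ne_zero
  have hA : Nat.card ((geomPoints W)[(p ^ n : ℕ)]) = (p ^ n) ^ 2 :=
    card_torsionBy_eq_sq (E := W.baseChange (AlgebraicClosure K)) (n := p ^ n) (by exact_mod_cast hp0)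
  have hcardL : Nat.card ((localPoints W (v.adicCompletion K))[(p ^ n : ℕ)]) = (p ^ n) ^ 2 :=
    card_torsionBy_eq_sq (E := W.baseChange (AlgebraicClosure (v.adicCompletion K)))
      (n := p ^ n) (by exact_mod_cast hp0)
  obtain ⟨Q, rfl⟩ := QuotientAddGroup.mk'_surjective (W.localKernelOfReduction v) y
  have hQ : p ^ n • Q ∈ W.localKernelOfReduction v := by
    rw [← QuotientAddGroup.eq_zero_iff, QuotientAddGroup.mk_nsmul]
    have h := AddSubgroup.torsionBy.nsmul_iff.mp hy
    rwa [QuotientAddGroup.mk'_apply] at h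
  obtain ⟨Q', hQ', hQ'Q⟩ := exists_torsion_sub_mem_localKernelOfReduction W hpv hmult n hQ
  haveI : Finite ((localPoints W (v.adicCompletion K))[(p ^ n : ℕ)]) :=
    Nat.finite_of_card_ne_zero (by rw [hcardL]; exact pow_ne_zero 2 hp0)
  obtain ⟨x, hx, hxQ⟩ := exists_mem_torsionBy_eq_of_injective (pointsMap W (v.adicCompletion K))
    (pointsMapOfEmb_injective W (closureEmb (K := K) (v.adicCompletion K))) (p ^ n)
    (le_of_eq (by rw [hcardL, hA])) Q' (AddSubgroup.torsionBy.nsmul_iff.mpr hQ')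
  refine ⟨x, hx, ?_⟩
  rw [AddMonoidHom.comp_apply, hxQ, QuotientAddGroup.mk'_apply, QuotientAddGroup.mk'_apply,
    QuotientAddGroup.eq_iff_sub_mem]
  exact hQ'Q

end Local

/-- **P2 ASSEMBLY (proved): `L1 → L7 → MultiplicativeOrdinaryFiltrationShape`.**  `f := (E(K̄) → E(K̄_v)/E₁)`,
`L := ker V_p f`; `finrank L = 2 - 1` (`RationalTateModule.finrank_ker_baseChange_map`, counts
`#E[pⁿ] = p²ⁿ`, L3, L5); `L` is `Γ_{K_v}`-stable (`E₁` is, `smul_mem_localKernelOfReduction_iff`); inertia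
acts trivially on `V/L` (L6 + L7); and by `χ_p` on `L` for free from `det = χ_p`
(`LinearMap.eq_det_smul_of_mem_of_finrank_eq_one`). [cite: SilvermanATAEC1994, V §5 Thm. 5.3] [cite: Greenberg1991, §2 (p. 214)] -/
theorem multiplicativeOrdinaryFiltration_of_L1_L7 (hL1 : L1Statement) (hL7 : L7Statement) :
    MultiplicativeOrdinaryFiltrationShape := by
  intro K _ _ W _ p hp v hpv hmult
  haveI : CharZero (AlgebraicClosure K) :=
    charZero_of_injective_algebraMap (algebraMap K (AlgebraicClosure K)).injective
  -- the reduction-type map `f : E(K̄) → E(K̄_v)/E₁(K̄_v)`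
  set f : geomPoints W →+ localPoints W (v.adicCompletion K) ⧸ W.localKernelOfReduction v :=
    (QuotientAddGroup.mk' (W.localKernelOfReduction v)).comp (pointsMap W (v.adicCompletion K))
    with hf
  have hf0 : ∀ a : geomPoints W, f a = 0 ↔ pointsMap W (v.adicCompletion K) a ∈ W.localKernelOfReduction v := by
    intro a
    rw [hf, AddMonoidHom.comp_apply, QuotientAddGroup.mk'_apply, QuotientAddGroup.eq_zero_iff]
  have hfσ : ∀ (σ : absoluteGaloisGroup (v.adicCompletion K)) (a : geomPoints W),
      pointsMap W (v.adicCompletion K) (absGaloisRestrict K (v.adicCompletion K) σ • a) =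
        σ • pointsMap W (v.adicCompletion K) a := by
    intro σ a
    rw [← resGal_eq_absGaloisRestrict, pointsMap_smul]
  -- Step 5': `ker f` is `Γ_{K_v}`-stable, inertia is trivial on the torsion of the target
  have hstab : ∀ (σ : absoluteGaloisGroup (v.adicCompletion K)) (a : geomPoints W),
      f a = 0 → f (absGaloisRestrict K (v.adicCompletion K) σ • a) = 0 := by
    intro σ a ha
    rw [hf0] at ha ⊢
    rw [hfσ]
    exact (W.smul_mem_localKernelOfReduction_iff v σ _).mpr ha
  have hinv : ∀ τ ∈ absInertia (v.adicCompletion K), ∀ n : ℕ, ∀ a ∈ (geomPoints W)[(p ^ n : ℕ)],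
      f (absGaloisRestrict K (v.adicCompletion K) τ • a) = f a := by
    intro τ hτ n a ha
    rw [hf, AddMonoidHom.comp_apply, AddMonoidHom.comp_apply, hfσ, QuotientAddGroup.mk'_apply,
      QuotientAddGroup.mk'_apply, QuotientAddGroup.eq_iff_sub_mem]
    refine hL7 W p v hpv hmult τ hτ n _ ?_
    rw [← map_nsmul, AddSubgroup.torsionBy.nsmul_iff.mp ha, map_zero]
  -- Step 6': counting
  have hp0 : ∀ n : ℕ, p ^ n ≠ 0 := fun n ↦ pow_ne_zero n hp.out.ne_zero
  have hA : ∀ n, Nat.card ((geomPoints W)[(p ^ n : ℕ)]) = p ^ (2 * n) := by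
    intro n
    have h := card_torsionBy_eq_sq (E := W.baseChange (AlgebraicClosure K)) (n := p ^ n)
      (by exact_mod_cast hp0 n)
    rw [← pow_mul, mul_comm] at h
    exact h
  have hB : ∀ n, Nat.card
      ((localPoints W (v.adicCompletion K) ⧸ W.localKernelOfReduction v)[(p ^ n : ℕ)]) = p ^ (1 * n) := by
    intro n
    rw [one_mul]
    exact natCard_torsionBy_quotient_localKernelOfReduction_eq W hpv hmult (hL1 W p v hpv hmult) n
  have hsurj : ∀ n, ∀ y ∈ ((localPoints W (v.adicCompletion K) ⧸ W.localKernelOfReduction v)[(p ^ n : ℕ)]),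
      ∃ x ∈ (geomPoints W)[(p ^ n : ℕ)], f x = y :=
    fun n y hy ↦ exists_torsionBy_comp_pointsMap_eq W hpv hmult n y hy
  -- Step 7 (verbatim): the line `F¹ = ker V_p(f)` and the four clauses
  let Lk : Submodule ℚ_[p] (W.rationalTateModule p) :=
    LinearMap.ker ((TateModule.map p f).baseChange ℚ_[p])
  have h1 : Module.finrank ℚ_[p] Lk = 1 :=
    RationalTateModule.finrank_ker_baseChange_map (f := f) hA hB hsurj
  have h2 : ∀ (τ : absoluteGaloisGroup (v.adicCompletion K)), ∀ x ∈ Lk,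
      W.rationalGaloisRepTate p (absGaloisRestrict K (v.adicCompletion K) τ) x ∈ Lk :=
    fun τ x hx ↦ RationalTateModule.baseChange_tateRepresentation_mem_ker_of_ker_stable f
      (absGaloisRestrict K (v.adicCompletion K) τ) (hstab τ) hx
  have h4 : ∀ τ ∈ absInertia (v.adicCompletion K), ∀ x : W.rationalTateModule p,
      W.rationalGaloisRepTate p (absGaloisRestrict K (v.adicCompletion K) τ) x - x ∈ Lk :=
    fun τ hτ x ↦ baseChange_tateRepresentation_sub_mem_ker_of_torsionBy f
      (absGaloisRestrict K (v.adicCompletion K) τ) (hinv τ hτ) x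
  haveI : Module.Finite ℚ_[p] (W.rationalTateModule p) :=
    module_finite_rationalTateModule_holds W p
  haveI : NeZero (p : K) := ⟨Nat.cast_ne_zero.mpr hp.out.ne_zero⟩
  have h3 : ∀ τ ∈ absInertia (v.adicCompletion K), ∀ x ∈ Lk,
      W.rationalGaloisRepTate p (absGaloisRestrict K (v.adicCompletion K) τ) x =
        (((GaloisRep.cyclotomicCharacter (v.adicCompletion K) p τ : ℤ_[p]ˣ) : ℤ_[p]) :
          ℚ_[p]) • x := by
    intro τ hτ x hx
    have hdet : LinearMap.det
        (W.rationalGaloisRepTate p (absGaloisRestrict K (v.adicCompletion K) τ) :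
          W.rationalTateModule p →ₗ[ℚ_[p]] W.rationalTateModule p) =
        (((GaloisRep.cyclotomicCharacter K p (absGaloisRestrict K (v.adicCompletion K) τ) :
          ℤ_[p]ˣ) : ℤ_[p]) : ℚ_[p]) :=
      det_rationalTateRepresentation_eq_cyclotomicCharacter W p _
    rw [LinearMap.eq_det_smul_of_mem_of_finrank_eq_one Lk h1 _ (h2 τ) (h4 τ hτ) x hx, hdet,
      cyclotomicCharacter_absGaloisRestrict]
  exact ⟨Lk, h1, h2, h3, h4⟩

/-- **P2 PROVED outright** (L1, L7 from §1–§2). [cite: SilvermanATAEC1994, V §5 Thm. 5.3] -/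
theorem multiplicativeOrdinaryFiltration : MultiplicativeOrdinaryFiltrationShape :=
  multiplicativeOrdinaryFiltration_of_L1_L7 l1Statement_holds l7Statement_holds

/-! ## §4 A3 (frame lemma) cut into one-liners — ALL PROVED: basis through the stable line, three matrix entries, frame transport -/

section FrameLA

variable {R M : Type*} [CommRing R] [AddCommGroup M] [Module R M]

/-- **A3b-i (XS, Mathlib-only) — PROVED.** If `f` maps `b₀` into the line `R b₀` then the `(1,0)` entry of
`[f]_b` vanishes (`LinearMap.toMatrix_apply`: `[f]_b i j = b.repr (f (b j)) i`). [folklore] -/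
theorem toMatrix_one_zero_eq_zero_of_map_mem_span (b : Module.Basis (Fin 2) R M) (f : M →ₗ[R] M)
    (hf : f (b 0) ∈ Submodule.span R {b 0}) : LinearMap.toMatrix b b f 1 0 = 0 := by
  obtain ⟨c, hc⟩ := Submodule.mem_span_singleton.mp hf
  simp [LinearMap.toMatrix_apply, ← hc]

/-- **A3b-ii (XS, Mathlib-only) — PROVED.** If `f b₀ = c • b₀` then `[f]_b 0 0 = c`. [folklore] -/
theorem toMatrix_zero_zero_eq_of_map_eq_smul (b : Module.Basis (Fin 2) R M) (f : M →ₗ[R] M)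
    {c : R} (hf : f (b 0) = c • b 0) : LinearMap.toMatrix b b f 0 0 = c := by
  simp [LinearMap.toMatrix_apply, hf]

/-- **A3b-iii (XS, Mathlib-only) — PROVED.** If `f b₁ - b₁ ∈ R b₀` then `[f]_b 1 1 = 1`. [folklore] -/
theorem toMatrix_one_one_eq_one_of_map_sub_mem_span (b : Module.Basis (Fin 2) R M) (f : M →ₗ[R] M)
    (hf : f (b 1) - b 1 ∈ Submodule.span R {b 0}) : LinearMap.toMatrix b b f 1 1 = 1 := by
  obtain ⟨c, hc⟩ := Submodule.mem_span_singleton.mp hf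
  have h1 : f (b 1) = c • b 0 + b 1 := by rw [← sub_eq_iff_eq_add, ← hc]
  simp [LinearMap.toMatrix_apply, h1]

/-- **A3a (XS/S, Mathlib-only) — PROVED.** A line `L` in a plane `V` is spanned by the first vector of some
basis of `V` (`Basis.extend` of a non-zero `ℓ ∈ L`, reindexed by `Fin 2`). [folklore] -/
theorem exists_basis_fin_two_through_line {F V : Type*} [Field F] [AddCommGroup V] [Module F V]
    (hV : Module.finrank F V = 2) (L : Submodule F V) (hL : Module.finrank F L = 1) :
    ∃ b : Module.Basis (Fin 2) F V, b 0 ∈ L ∧ ∀ x ∈ L, ∃ c : F, x = c • b 0 := by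
  classical
  -- a generator of the line
  obtain ⟨x₀, hx₀ne, hx₀gen⟩ := finrank_eq_one_iff'.mp hL
  have hx₀V : (x₀ : V) ≠ 0 := fun h => hx₀ne (Subtype.ext h)
  -- extend it to a basis of `V` (`![x₀, y]`, then `basisOfLinearIndependentOfCardEqFinrank`)
  obtain ⟨y, hli⟩ := exists_linearIndependent_pair_of_one_lt_finrank (R := F) (by omega) hx₀V
  refine ⟨basisOfLinearIndependentOfCardEqFinrank hli (by simp [hV]), ?_, ?_⟩
  · simp
  · intro x hx
    obtain ⟨c, hc⟩ := hx₀gen ⟨x, hx⟩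
    refine ⟨c, ?_⟩
    have hc' := congrArg Subtype.val hc
    simp only [SetLike.val_smul] at hc'
    simp [← hc']

end FrameLA

/-! ## §4b A3c — transport to the tree's pinned frame `W.framedTateGaloisRep p` (GEN 10, NEW, PROVED)

The extremal frame: by `exists_conj_framedTateGaloisRep_eq_ofBasis` the pinned framed representation is
conjugate to `framedTateGaloisRepOfBasis p h b` for ANY basis `b`, and `IsOrdinaryOfWeightAt` is
conjugation-invariant (`isOrdinaryOfWeightAt_conj_iff`), so one may take `b` THROUGH the stable line
(A3a) and then the Skinner–Wiles frame `Q := 1`; the three matrix entries are A3b-i/ii/iii read through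
`coe_framedTateGaloisRepOfBasis_apply` + `Matrix.map_apply`. -/
section Frame

variable {K : Type} [Field K] [NumberField K] (W : WeierstrassCurve K) [W.IsElliptic]
  (v : HeightOneSpectrum (𝓞 K)) (p : ℕ) [hp : Fact p.Prime]

omit [W.IsElliptic] in
/-- **A3c′ (frame form, PROVED).** In a basis `b` whose first vector spans a `Γ_{K_v}`-stable line with
inertia acting by `χ_p` on it and trivially on the quotient, the frame `Q = 1` exhibits
`IsOrdinaryOfWeightAt p (W.framedTateGaloisRepOfBasis p h b) v 2 1`. [folklore] -/
theorem isOrdinaryOfWeightAt_two_one_framedTateGaloisRepOfBasis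
    (h : Continuous fun x : absoluteGaloisGroup K × RationalTateModule (geomPoints W) p ↦
      rationalTateRepresentation (absoluteGaloisGroup K) (geomPoints W) p x.1 x.2)
    (b : Module.Basis (Fin 2) ℚ_[p] (W.rationalTateModule p))
    (hst : ∀ (τ : absoluteGaloisGroup (v.adicCompletion K)),
      W.rationalGaloisRepTate p (absGaloisRestrict K (v.adicCompletion K) τ) (b 0) ∈
        Submodule.span ℚ_[p] {b 0})
    (hχ : ∀ τ ∈ absInertia (v.adicCompletion K),
      W.rationalGaloisRepTate p (absGaloisRestrict K (v.adicCompletion K) τ) (b 0) =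
        (((GaloisRep.cyclotomicCharacter (v.adicCompletion K) p τ : ℤ_[p]ˣ) : ℤ_[p]) : ℚ_[p]) • b 0)
    (hquot : ∀ τ ∈ absInertia (v.adicCompletion K),
      W.rationalGaloisRepTate p (absGaloisRestrict K (v.adicCompletion K) τ) (b 1) - b 1 ∈
        Submodule.span ℚ_[p] {b 0}) :
    FramedGaloisRep.IsOrdinaryOfWeightAt p (W.framedTateGaloisRepOfBasis p h b) v 2 1 := by
  rw [FramedGaloisRep.isOrdinaryOfWeightAt_iff]
  refine ⟨1, fun σ => ?_⟩
  simp only [inv_one, one_mul, mul_one, pow_one, FramedGaloisRep.toLocal_apply]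
  have hval : ∀ i j : Fin 2, (W.framedTateGaloisRepOfBasis p h b
        (absGaloisRestrict K (v.adicCompletion K) σ)).val i j =
      algebraMap ℚ_[p] (PadicAlgCl p) (LinearMap.toMatrix b b
        (W.rationalGaloisRepTate p (absGaloisRestrict K (v.adicCompletion K) σ) :
          W.rationalTateModule p →ₗ[ℚ_[p]] W.rationalTateModule p) i j) := by
    intro i j
    have := congrFun (congrFun (W.coe_framedTateGaloisRepOfBasis_apply p h b
      (absGaloisRestrict K (v.adicCompletion K) σ)) i) j
    rw [Matrix.map_apply] at this
    exact this
  refine ⟨?_, fun hσ => ⟨?_, ?_⟩⟩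
  · rw [hval, toMatrix_one_zero_eq_zero_of_map_mem_span b _ (hst σ), map_zero]
  · rw [hval, toMatrix_one_one_eq_one_of_map_sub_mem_span b _ (hquot σ hσ), map_one]
  · rw [hval, toMatrix_zero_zero_eq_of_map_eq_smul b _ (hχ σ hσ),
      IsScalarTower.algebraMap_apply ℤ_[p] ℚ_[p] (PadicAlgCl p)]
    norm_num

/-- **A3c (S) — gen-8 A3 signature VERBATIM — PROVED.** [cite: SkinnerWiles1999, §1 Theorem (ii)]
[cite: Greenberg1991, §2 (p. 214)] -/
theorem isOrdinaryOfWeightAt_two_one_of_stableLine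
    (L : Submodule ℚ_[p] (W.rationalTateModule p)) (hL1 : Module.finrank ℚ_[p] L = 1)
    (hst : ∀ (τ : absoluteGaloisGroup (v.adicCompletion K)), ∀ x ∈ L,
      W.rationalGaloisRepTate p (absGaloisRestrict K (v.adicCompletion K) τ) x ∈ L)
    (hχ : ∀ τ ∈ absInertia (v.adicCompletion K), ∀ x ∈ L,
      W.rationalGaloisRepTate p (absGaloisRestrict K (v.adicCompletion K) τ) x =
        (((GaloisRep.cyclotomicCharacter (v.adicCompletion K) p τ : ℤ_[p]ˣ) : ℤ_[p]) : ℚ_[p]) • x)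
    (hquot : ∀ τ ∈ absInertia (v.adicCompletion K), ∀ x : W.rationalTateModule p,
      W.rationalGaloisRepTate p (absGaloisRestrict K (v.adicCompletion K) τ) x - x ∈ L) :
    FramedGaloisRep.IsOrdinaryOfWeightAt p (W.framedTateGaloisRep p) v 2 1 := by
  have hV : Module.finrank ℚ_[p] (W.rationalTateModule p) = 2 :=
    W.finrank_rationalTateModule_eq_two_holds p (Nat.cast_ne_zero.2 hp.out.ne_zero)
  obtain ⟨b, hb0, hbL⟩ := exists_basis_fin_two_through_line hV L hL1
  have hLspan : ∀ x ∈ L, x ∈ Submodule.span ℚ_[p] {b 0} := fun x hx ↦ by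
    obtain ⟨c, hc⟩ := hbL x hx
    exact Submodule.mem_span_singleton.mpr ⟨c, hc.symm⟩
  set h := W.continuous_rationalGaloisRepTate_holds p with hh
  obtain ⟨P, hP⟩ := W.exists_conj_framedTateGaloisRep_eq_ofBasis p h b
  rw [← FramedGaloisRep.isOrdinaryOfWeightAt_conj_iff P, hP]
  exact isOrdinaryOfWeightAt_two_one_framedTateGaloisRepOfBasis W v p h b
    (fun τ ↦ hLspan _ (hst τ (b 0) hb0)) (fun τ hτ ↦ hχ τ hτ (b 0) hb0)
    (fun τ hτ ↦ hLspan _ (hquot τ hτ (b 1)))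

end Frame

/-! ## §5 The theorem of the line: multiplicative at `v ∣ p` ⇒ ordinary of weight 2, exponent 1 (PROVED)

Cross-slot service.  The `stub_liftThree` k3 line (`STUB_IDEAS_stub_liftThree_3g7.lean` … `_3g9.lean`) types the
local ordinary condition as `HasOrdinaryLineAt W p v := ∃ L, (the four clauses)` — definitionally the body of
`MultiplicativeOrdinaryFiltrationShape` at `(W, p, v)` — proves it at `p = 3` over `ℚ` by the Kato-filtration
road (their M4) and leaves OPEN since their gen 7 the framed form **L2f**
`isOrdinaryOfWeightAt_framedTateGaloisRep_of_hasOrdinaryLineAt` and the generic-`p` **L2**.  The two theorems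
below are exactly those, with `HasOrdinaryLineAt` unfolded (so `exact` closes their verbatim signatures):
L2 at `v ∣ p` = P2 (any `K`, `p`), L2f = A3c (any `K`, `p`, `v`). -/

section Final

variable {K : Type} [Field K] [NumberField K] (W : WeierstrassCurve K) [W.IsElliptic]
  (p : ℕ) [hp : Fact p.Prime] (v : HeightOneSpectrum (𝓞 K))

/-- **L2 (liftThree-k3 gen 7, `HasOrdinaryLineAt W p v` unfolded) at `v ∣ p` — PROVED for every number
field and prime** (= P2).  (Their typing omits `hpv`; at a multiplicative `v ∤ p` the line exists too, by the
Tate basis of `MultiplicativeInertiaLineProofs`, but no consumer asks for it.)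
[cite: SilvermanATAEC1994, V §5 Thm. 5.3; V §6 Prop. 6.1] [cite: Greenberg1991, §2 (p. 214)] -/
theorem exists_ordinaryLine_of_hasMultiplicativeReductionAt
    (hpv : ((p : ℕ) : 𝓞 K) ∈ v.asIdeal) (hmult : W.HasMultiplicativeReductionAt v) :
    ∃ L : Submodule (Padic p) (W.rationalTateModule p),
      Module.finrank (Padic p) L = 1 ∧
      (∀ (τ : absoluteGaloisGroup (v.adicCompletion K)), ∀ x ∈ L,
        W.rationalGaloisRepTate p (absGaloisRestrict K (v.adicCompletion K) τ) x ∈ L) ∧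
      (∀ τ ∈ absInertia (v.adicCompletion K), ∀ x ∈ L,
        W.rationalGaloisRepTate p (absGaloisRestrict K (v.adicCompletion K) τ) x =
          (((GaloisRep.cyclotomicCharacter (v.adicCompletion K) p τ : (PadicInt p)ˣ) : PadicInt p) :
            Padic p) • x) ∧
      (∀ τ ∈ absInertia (v.adicCompletion K), ∀ x : W.rationalTateModule p,
        W.rationalGaloisRepTate p (absGaloisRestrict K (v.adicCompletion K) τ) x - x ∈ L) :=
  multiplicativeOrdinaryFiltration W p v hpv hmult

/-- **L2f (liftThree-k3 gen 7, `HasOrdinaryLineAt W p v` unfolded) — PROVED for every `K`, `p`, `v`**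
(= A3c): an ordinary line makes `W.framedTateGaloisRep p` ordinary of weight `2`, exponent `1`, at `v`.
[cite: SkinnerWiles1999, §1 Theorem (ii)] -/
theorem isOrdinaryOfWeightAt_framedTateGaloisRep_of_exists_ordinaryLine
    (h : ∃ L : Submodule (Padic p) (W.rationalTateModule p),
      Module.finrank (Padic p) L = 1 ∧
      (∀ (τ : absoluteGaloisGroup (v.adicCompletion K)), ∀ x ∈ L,
        W.rationalGaloisRepTate p (absGaloisRestrict K (v.adicCompletion K) τ) x ∈ L) ∧
      (∀ τ ∈ absInertia (v.adicCompletion K), ∀ x ∈ L,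
        W.rationalGaloisRepTate p (absGaloisRestrict K (v.adicCompletion K) τ) x =
          (((GaloisRep.cyclotomicCharacter (v.adicCompletion K) p τ : (PadicInt p)ˣ) : PadicInt p) :
            Padic p) • x) ∧
      (∀ τ ∈ absInertia (v.adicCompletion K), ∀ x : W.rationalTateModule p,
        W.rationalGaloisRepTate p (absGaloisRestrict K (v.adicCompletion K) τ) x - x ∈ L)) :
    FramedGaloisRep.IsOrdinaryOfWeightAt p (W.framedTateGaloisRep p) v 2 1 := by
  obtain ⟨L, h1, h2, h3, h4⟩ := h
  exact isOrdinaryOfWeightAt_two_one_of_stableLine W v p L h1 h2 h3 h4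

/-- **THE LOCAL CORNER THEOREM (PROVED, sorry-free): multiplicative reduction at `v ∣ p` ⇒
`ρ_{E,p}|D_v` is ordinary of weight `2` with exponent `1`** in the Skinner–Wiles sense of
`FramedGaloisRep.IsOrdinaryOfWeightAt` (some frame in which `D_v` is upper-triangular with inertia
acting by `χ_p` on the line and trivially on the quotient).  Conrad (in Cornell–Silverman–Stevens
1997, p. 446) Thm. 1.1, multiplicative case; Silverman ATAEC V §5 Thm. 5.3 / §6 Prop. 6.1; Greenberg
1991 §2.  Proof = L2 (P2, §3) + L2f (A3c, §4b).
[cite: SilvermanATAEC1994, V §5 Thm. 5.3; V §6 Prop. 6.1] [cite: Greenberg1991, §2 (p. 214)]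
[cite: SkinnerWiles1999, §1 Theorem (ii)] -/
theorem isOrdinaryOfWeightAt_framedTateGaloisRep_of_hasMultiplicativeReductionAt
    (hpv : ((p : ℕ) : 𝓞 K) ∈ v.asIdeal) (hmult : W.HasMultiplicativeReductionAt v) :
    FramedGaloisRep.IsOrdinaryOfWeightAt p (W.framedTateGaloisRep p) v 2 1 :=
  isOrdinaryOfWeightAt_framedTateGaloisRep_of_exists_ordinaryLine W p v
    (exists_ordinaryLine_of_hasMultiplicativeReductionAt W p v hpv hmult)

end Final

/-- **P2′ PROVED: `OrdinaryWeightTwoAtFiveShape`** (gen-6/8 shape verbatim) — the hypothesis `hP2` of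
gen 6's PROVED `liftFiveLocalCorner_of_wiles`; with gen 7's PROVED `typeAOffFive` (P4) the consumption
`E6 → (case B of stub_liftFive)` has no local debt left. [cite: SkinnerWiles1999, §1 Theorem (ii)]
[cite: SilvermanATAEC1994, V §5 Thm. 5.3] -/
theorem ordinaryWeightTwoAtFive : OrdinaryWeightTwoAtFiveShape := by
  intro W _ v h5v hmult
  haveI : Fact (Nat.Prime 5) := ⟨Nat.prime_five⟩
  exact isOrdinaryOfWeightAt_framedTateGaloisRep_of_hasMultiplicativeReductionAt W 5 v h5v hmult

end Summit.ABC.ABC.Cruxes.FreyModularity.StubIdeas.LiftFive3g10
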